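import Mathlib
import HarnessLib
import Summits.NavierStokesRegularity.NavierStokesRegularity.Theorems.PoloidalWindowDoorLrcModEntireAxisKinematics6
import Summits.NavierStokesRegularity.NavierStokesRegularity.Theorems.PoloidalWindowDoorLrcModEntireAxisKinematics3

/-!
# Route `PoloidalWindowDoor`, item `LrcModEntire` (stmt-NavierStokesRegularity-20428) — AXIS KINEMATICS VIII: composition calculus for a
# radial profile about a moving centre, `V = P(ρ_c², z)` — the coefficients of the identity (★)

Cell ns-regularity-ideate, seat ns-poloidal-K2-p3 gen 5 (LEAD of item 20428; file landed `--supports stmt-NavierStokesRegularity-20428` as a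
helper).  Plan step VII of AXIS-NOTE: for `W(y) := P(g(y), y₂)`, `g(y) = (y₀ − c₀(y₂))² + (y₁ − c₁(y₂))²`, with `Ψ(y) = (g y, y₂)`,
`P_r := DP(·)(1,0)`, `P_z := DP(·)(0,1)`:

* `fderiv_comp_apply_pair` — `DP(q)(d₁, d₂) = d₁ P_r(q) + d₂ P_z(q)`;
* `fderiv_radialMoving_horizontal` — **`DW(y)[p] = 2 U_p(y) P_r(Ψy)`** for horizontal `p` (`p₂ = 0`), `U_p = (y₀−c₀)p₀ + (y₁−c₁)p₁`;
* `fderiv_radialMoving_vertical` — **`DW(y)[e₂] = −2 U_{c′}(y) P_r(Ψy) + P_z(Ψy)`** (`U_{c′} = (y₀−c₀)c₀′ + (y₁−c₁)c₁′`);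
* `fderiv_Ucprime_horizontal` — `D U_{c′}(y)[w] = w₀c₀′ + w₁c₁′` for horizontal `w` (`c ∈ C²`).

(The second-order coefficient `∂_w∂₂W = −2(w·c′)P_r − 4U_{c′}U_w P_rr + 2U_w P_zr` is the successor's next lemma: differentiate
`fderiv_radialMoving_vertical` as a function near `y` with these three bricks.)

WHAT THIS IS NOT: not a claim about Navier–Stokes regularity and not the axis lemma — calculus (bears_on LADDER-NS N0 via item 20428).
-/

noncomputable section

-- the summit and its single sub-problem share the name (CONVENTIONS §1), as in every Theorems file
set_option linter.dupNamespace false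

namespace Summit.NavierStokesRegularity.NavierStokesRegularity.Theorems.PoloidalWindowDoorLrcModEntireAxisKinematics8

open Set Function Filter Topology Metric
open scoped RealInnerProductSpace InnerProductSpace
open Literature.Analysis Literature.Analysis.FluidPDE
open Summit.NavierStokesRegularity.NavierStokesRegularity.Theorems.PoloidalWindowDoorLrcModEntireAxisKinematics6

variable {c₀ c₁ : ℝ → ℝ} {P : ℝ × ℝ → ℝ}

/-- `DP(q)(d₁, d₂) = d₁·DP(q)(1,0) + d₂·DP(q)(0,1)`. -/
theorem fderiv_comp_apply_pair (q : ℝ × ℝ) (d₁ d₂ : ℝ) :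
    fderiv ℝ P q (d₁, d₂) = d₁ * fderiv ℝ P q (1, 0) + d₂ * fderiv ℝ P q (0, 1) := by
  have e : ((d₁, d₂) : ℝ × ℝ) = d₁ • ((1 : ℝ), (0 : ℝ)) + d₂ • ((0 : ℝ), (1 : ℝ)) := by ext <;> simp
  rw [e, map_add, map_smul, map_smul, smul_eq_mul, smul_eq_mul]

/-- **Horizontal derivative of `W = P(ρ_c², z)`**: `DW(y)[p] = 2 U_p(y) · P_r(Ψ y)` for `p₂ = 0`. -/
theorem fderiv_radialMoving_horizontal {y : EuclideanSpace ℝ (Fin 3)} (hc₀ : DifferentiableAt ℝ c₀ (y 2))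
    (hc₁ : DifferentiableAt ℝ c₁ (y 2)) (hP : DifferentiableAt ℝ P ((y 0 - c₀ (y 2)) ^ 2 + (y 1 - c₁ (y 2)) ^ 2, y 2))
    {p : EuclideanSpace ℝ (Fin 3)} (hp : p 2 = 0) :
    fderiv ℝ (fun y' : EuclideanSpace ℝ (Fin 3) => P ((y' 0 - c₀ (y' 2)) ^ 2 + (y' 1 - c₁ (y' 2)) ^ 2, y' 2)) y p =
      2 * ((y 0 - c₀ (y 2)) * p 0 + (y 1 - c₁ (y 2)) * p 1) *
        fderiv ℝ P ((y 0 - c₀ (y 2)) ^ 2 + (y 1 - c₁ (y 2)) ^ 2, y 2) (1, 0) := by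
  have hΨ := (hasFDerivAt_sqDistMoving hc₀ hc₁).prodMk
    ((EuclideanSpace.proj (2 : Fin 3) : EuclideanSpace ℝ (Fin 3) →L[ℝ] ℝ).hasFDerivAt)
  have hW : HasFDerivAt (fun y' : EuclideanSpace ℝ (Fin 3) => P ((y' 0 - c₀ (y' 2)) ^ 2 + (y' 1 - c₁ (y' 2)) ^ 2, y' 2)) _ y :=
    hP.hasFDerivAt.comp y hΨ
  rw [hW.fderiv]
  have hp0 : (EuclideanSpace.proj (0 : Fin 3) : EuclideanSpace ℝ (Fin 3) →L[ℝ] ℝ) p = p 0 := rfl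
  have hp1 : (EuclideanSpace.proj (1 : Fin 3) : EuclideanSpace ℝ (Fin 3) →L[ℝ] ℝ) p = p 1 := rfl
  have hp2 : (EuclideanSpace.proj (2 : Fin 3) : EuclideanSpace ℝ (Fin 3) →L[ℝ] ℝ) p = 0 := hp
  simp only [ContinuousLinearMap.comp_apply, ContinuousLinearMap.prod_apply, add_apply, sub_apply, smul_apply, smul_eq_mul,
    hp0, hp1, hp2, mul_zero, sub_zero]
  rw [fderiv_comp_apply_pair]
  ring

/-- **Vertical derivative of `W = P(ρ_c², z)`**: `DW(y)[e₂] = −2 U_{c′}(y) · P_r(Ψ y) + P_z(Ψ y)`. -/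
theorem fderiv_radialMoving_vertical {y : EuclideanSpace ℝ (Fin 3)} (hc₀ : DifferentiableAt ℝ c₀ (y 2))
    (hc₁ : DifferentiableAt ℝ c₁ (y 2)) (hP : DifferentiableAt ℝ P ((y 0 - c₀ (y 2)) ^ 2 + (y 1 - c₁ (y 2)) ^ 2, y 2)) :
    fderiv ℝ (fun y' : EuclideanSpace ℝ (Fin 3) => P ((y' 0 - c₀ (y' 2)) ^ 2 + (y' 1 - c₁ (y' 2)) ^ 2, y' 2)) y
        (EuclideanSpace.single 2 1) =
      -2 * ((y 0 - c₀ (y 2)) * deriv c₀ (y 2) + (y 1 - c₁ (y 2)) * deriv c₁ (y 2)) *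
          fderiv ℝ P ((y 0 - c₀ (y 2)) ^ 2 + (y 1 - c₁ (y 2)) ^ 2, y 2) (1, 0) +
        fderiv ℝ P ((y 0 - c₀ (y 2)) ^ 2 + (y 1 - c₁ (y 2)) ^ 2, y 2) (0, 1) := by
  have hΨ := (hasFDerivAt_sqDistMoving hc₀ hc₁).prodMk
    ((EuclideanSpace.proj (2 : Fin 3) : EuclideanSpace ℝ (Fin 3) →L[ℝ] ℝ).hasFDerivAt)
  have hW : HasFDerivAt (fun y' : EuclideanSpace ℝ (Fin 3) => P ((y' 0 - c₀ (y' 2)) ^ 2 + (y' 1 - c₁ (y' 2)) ^ 2, y' 2)) _ y :=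
    hP.hasFDerivAt.comp y hΨ
  rw [hW.fderiv]
  have hp0 : (EuclideanSpace.proj (0 : Fin 3) : EuclideanSpace ℝ (Fin 3) →L[ℝ] ℝ) (EuclideanSpace.single 2 (1 : ℝ)) = 0 := by
    show (EuclideanSpace.single 2 (1 : ℝ) : EuclideanSpace ℝ (Fin 3)) 0 = 0; simp
  have hp1 : (EuclideanSpace.proj (1 : Fin 3) : EuclideanSpace ℝ (Fin 3) →L[ℝ] ℝ) (EuclideanSpace.single 2 (1 : ℝ)) = 0 := by
    show (EuclideanSpace.single 2 (1 : ℝ) : EuclideanSpace ℝ (Fin 3)) 1 = 0; simp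
  have hp2 : (EuclideanSpace.proj (2 : Fin 3) : EuclideanSpace ℝ (Fin 3) →L[ℝ] ℝ) (EuclideanSpace.single 2 (1 : ℝ)) = 1 := by
    show (EuclideanSpace.single 2 (1 : ℝ) : EuclideanSpace ℝ (Fin 3)) 2 = 1; simp
  simp only [ContinuousLinearMap.comp_apply, ContinuousLinearMap.prod_apply, add_apply, sub_apply, smul_apply, smul_eq_mul,
    hp0, hp1, hp2, mul_one, zero_sub]
  rw [fderiv_comp_apply_pair]
  ring

/-- **Horizontal derivative of `U_{c′}`**: for `c₀, c₁` with differentiable derivatives at `y₂` and a horizontal `w` (`w₂ = 0`),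
`D[(y₀ − c₀(y₂)) c₀′(y₂) + (y₁ − c₁(y₂)) c₁′(y₂)](y)[w] = w₀ c₀′(y₂) + w₁ c₁′(y₂)`. -/
theorem fderiv_Ucprime_horizontal {y : EuclideanSpace ℝ (Fin 3)} (hc₀ : DifferentiableAt ℝ c₀ (y 2))
    (hc₁ : DifferentiableAt ℝ c₁ (y 2)) (hd₀ : DifferentiableAt ℝ (deriv c₀) (y 2)) (hd₁ : DifferentiableAt ℝ (deriv c₁) (y 2))
    {w : EuclideanSpace ℝ (Fin 3)} (hw : w 2 = 0) :
    fderiv ℝ (fun y' : EuclideanSpace ℝ (Fin 3) =>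
        (y' 0 - c₀ (y' 2)) * deriv c₀ (y' 2) + (y' 1 - c₁ (y' 2)) * deriv c₁ (y' 2)) y w =
      w 0 * deriv c₀ (y 2) + w 1 * deriv c₁ (y 2) := by
  have h2 : HasFDerivAt (fun y' : EuclideanSpace ℝ (Fin 3) => y' 2)
      (EuclideanSpace.proj (2 : Fin 3) : EuclideanSpace ℝ (Fin 3) →L[ℝ] ℝ) y :=
    (EuclideanSpace.proj (2 : Fin 3) : EuclideanSpace ℝ (Fin 3) →L[ℝ] ℝ).hasFDerivAt
  have hA := Summit.NavierStokesRegularity.NavierStokesRegularity.Theorems.PoloidalWindowDoorLrcModEntireAxisKinematics3.hasFDerivAt_coordSubFun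
    hc₀ 0 (y := y)
  have hB := Summit.NavierStokesRegularity.NavierStokesRegularity.Theorems.PoloidalWindowDoorLrcModEntireAxisKinematics3.hasFDerivAt_coordSubFun
    hc₁ 1 (y := y)
  have hD0 : HasFDerivAt (fun y' : EuclideanSpace ℝ (Fin 3) => deriv c₀ (y' 2))
      (deriv (deriv c₀) (y 2) • (EuclideanSpace.proj (2 : Fin 3) : EuclideanSpace ℝ (Fin 3) →L[ℝ] ℝ)) y := by
    exact hd₀.hasDerivAt.comp_hasFDerivAt y h2
  have hD1 : HasFDerivAt (fun y' : EuclideanSpace ℝ (Fin 3) => deriv c₁ (y' 2))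
      (deriv (deriv c₁) (y 2) • (EuclideanSpace.proj (2 : Fin 3) : EuclideanSpace ℝ (Fin 3) →L[ℝ] ℝ)) y := by
    exact hd₁.hasDerivAt.comp_hasFDerivAt y h2
  have hF : HasFDerivAt (fun y' : EuclideanSpace ℝ (Fin 3) =>
        (y' 0 - c₀ (y' 2)) * deriv c₀ (y' 2) + (y' 1 - c₁ (y' 2)) * deriv c₁ (y' 2)) _ y :=
    (hA.mul hD0).add (hB.mul hD1)
  rw [hF.fderiv]
  have hp0 : (EuclideanSpace.proj (0 : Fin 3) : EuclideanSpace ℝ (Fin 3) →L[ℝ] ℝ) w = w 0 := rfl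
  have hp1 : (EuclideanSpace.proj (1 : Fin 3) : EuclideanSpace ℝ (Fin 3) →L[ℝ] ℝ) w = w 1 := rfl
  have hp2 : (EuclideanSpace.proj (2 : Fin 3) : EuclideanSpace ℝ (Fin 3) →L[ℝ] ℝ) w = 0 := hw
  simp only [add_apply, sub_apply, smul_apply, smul_eq_mul, hp0, hp1, hp2, mul_zero, sub_zero]
  ring

end Summit.NavierStokesRegularity.NavierStokesRegularity.Theorems.PoloidalWindowDoorLrcModEntireAxisKinematics8

end
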